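import Mathlib

/-!
# Stub `stub_filtrationFinrank` for `FreeSubtorus.OrbitDimensionBound`, line `Sketch`

Dimension bookkeeping for the coordinate filtration of a subspace `U ≤ (Fin n → W)`:
with `F_i = {v ∈ U : v j = 0 for all j < i}` and `K_i = proj_i (F_i) ≤ W`, one has
`Σ_i dim K_i = dim U`.  Proof: rank–nullity for `proj_i` restricted to `F_i` (its kernel is
`F_{i+1}`), `F_0 = U`, `F_n = ⊥`, and telescoping along the `ℕ`-indexed copy
`F k = U ⊓ ⨅ (j : Fin n) (_ : ↑j < k), ker proj_j` of the filtration (written out in every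
statement below; no auxiliary definition is introduced).
-/

set_option linter.dupNamespace false

namespace Summit.ValiantsHypothesis.ValiantsHypothesis.Theorems.FreeSubtorusOrbitDimensionBound

open Module

variable {n : ℕ} {W : Type} [AddCommGroup W] [Module ℂ W]

/-- Membership in the `ℕ`-indexed coordinate filtration
`F k = {v ∈ U : v j = 0 for all j < k}`. [folklore] -/
theorem mem_coordFilt (U : Submodule ℂ (Fin n → W)) (k : ℕ) (v : Fin n → W) :
    v ∈ U ⊓ ⨅ (j : Fin n) (_ : (j : ℕ) < k),
        LinearMap.ker (LinearMap.proj j : (Fin n → W) →ₗ[ℂ] W) ↔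
      v ∈ U ∧ ∀ j : Fin n, (j : ℕ) < k → v j = 0 := by
  simp [Submodule.mem_iInf, LinearMap.mem_ker]

/-- `F 0 = U`. [folklore] -/
theorem coordFilt_zero (U : Submodule ℂ (Fin n → W)) :
    U ⊓ ⨅ (j : Fin n) (_ : (j : ℕ) < 0),
        LinearMap.ker (LinearMap.proj j : (Fin n → W) →ₗ[ℂ] W) = U := by
  ext v
  rw [mem_coordFilt]
  simp

/-- `F k = ⊥` once all coordinates are forced to vanish (`n ≤ k`). [folklore] -/
theorem coordFilt_eq_bot (U : Submodule ℂ (Fin n → W)) {k : ℕ} (hk : n ≤ k) :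
    U ⊓ ⨅ (j : Fin n) (_ : (j : ℕ) < k),
        LinearMap.ker (LinearMap.proj j : (Fin n → W) →ₗ[ℂ] W) = ⊥ := by
  rw [eq_bot_iff]
  intro v hv
  rw [mem_coordFilt] at hv
  rw [Submodule.mem_bot]
  funext j
  exact hv.2 j (lt_of_lt_of_le j.isLt hk)

/-- One step of the filtration: `F (k+1) = F k ⊓ ker proj_k` for `k < n`. [folklore] -/
theorem coordFilt_succ (U : Submodule ℂ (Fin n → W)) (k : ℕ) (hk : k < n) :
    U ⊓ ⨅ (j : Fin n) (_ : (j : ℕ) < k + 1),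
        LinearMap.ker (LinearMap.proj j : (Fin n → W) →ₗ[ℂ] W) =
      (U ⊓ ⨅ (j : Fin n) (_ : (j : ℕ) < k),
          LinearMap.ker (LinearMap.proj j : (Fin n → W) →ₗ[ℂ] W)) ⊓
        LinearMap.ker (LinearMap.proj (⟨k, hk⟩ : Fin n) : (Fin n → W) →ₗ[ℂ] W) := by
  ext v
  simp only [Submodule.mem_inf, Submodule.mem_iInf, LinearMap.mem_ker, LinearMap.coe_proj,
    Function.eval]
  constructor
  · rintro ⟨hU, h⟩
    exact ⟨⟨hU, fun j hj => h j (Nat.lt_succ_of_lt hj)⟩, h ⟨k, hk⟩ (Nat.lt_succ_self k)⟩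
  · rintro ⟨⟨hU, h⟩, hk'⟩
    refine ⟨hU, fun j hj => ?_⟩
    rcases Nat.lt_succ_iff_lt_or_eq.mp hj with hj | hj
    · exact h j hj
    · obtain rfl : j = ⟨k, hk⟩ := Fin.ext hj
      exact hk'

/-- Rank–nullity for `proj_k` restricted to `F k`: its image is `K_k = proj_k (F k)` and its
kernel is `F (k+1)`, so `dim F k = dim K_k + dim F (k+1)`. [folklore] -/
theorem finrank_coordFilt_step [FiniteDimensional ℂ W] (U : Submodule ℂ (Fin n → W)) (k : ℕ)
    (hk : k < n) :
    finrank ℂ ↥(U ⊓ ⨅ (j : Fin n) (_ : (j : ℕ) < k),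
        LinearMap.ker (LinearMap.proj j : (Fin n → W) →ₗ[ℂ] W)) =
      finrank ℂ
          ((U ⊓ ⨅ (j : Fin n) (_ : (j : ℕ) < k),
              LinearMap.ker (LinearMap.proj j : (Fin n → W) →ₗ[ℂ] W)).map
            (LinearMap.proj (⟨k, hk⟩ : Fin n) : (Fin n → W) →ₗ[ℂ] W)) +
        finrank ℂ ↥(U ⊓ ⨅ (j : Fin n) (_ : (j : ℕ) < k + 1),
          LinearMap.ker (LinearMap.proj j : (Fin n → W) →ₗ[ℂ] W)) := by
  have h := LinearMap.finrank_range_add_finrank_ker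
    ((LinearMap.proj (⟨k, hk⟩ : Fin n) : (Fin n → W) →ₗ[ℂ] W).domRestrict
      (U ⊓ ⨅ (j : Fin n) (_ : (j : ℕ) < k),
        LinearMap.ker (LinearMap.proj j : (Fin n → W) →ₗ[ℂ] W)))
  rw [LinearMap.range_domRestrict, LinearMap.ker_domRestrict] at h
  rw [← h, coordFilt_succ U k hk]
  congr 1
  refine LinearEquiv.finrank_eq ?_
  refine (LinearEquiv.ofEq _ _ ?_).trans (Submodule.comapSubtypeEquivOfLe inf_le_left)
  rw [Submodule.comap_inf, Submodule.comap_subtype_self, top_inf_eq]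

/-- Telescoped form: `dim U = Σ_{i<k} dim K_i + dim F k` for `k ≤ n`. [folklore] -/
theorem finrank_eq_sum_range_add_finrank_coordFilt [FiniteDimensional ℂ W]
    (U : Submodule ℂ (Fin n → W)) :
    ∀ k : ℕ, k ≤ n →
      finrank ℂ U =
        (∑ i ∈ Finset.range k,
            if h : i < n then
              finrank ℂ
                ((U ⊓ ⨅ (j : Fin n) (_ : (j : ℕ) < i),
                    LinearMap.ker (LinearMap.proj j : (Fin n → W) →ₗ[ℂ] W)).map
                  (LinearMap.proj (⟨i, h⟩ : Fin n) : (Fin n → W) →ₗ[ℂ] W))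
            else 0) +
          finrank ℂ ↥(U ⊓ ⨅ (j : Fin n) (_ : (j : ℕ) < k),
            LinearMap.ker (LinearMap.proj j : (Fin n → W) →ₗ[ℂ] W))
  | 0, _ => by rw [Finset.sum_range_zero, zero_add, coordFilt_zero]
  | k + 1, hk => by
    have hk' : k < n := Nat.lt_of_succ_le hk
    rw [finrank_eq_sum_range_add_finrank_coordFilt U k hk'.le, Finset.sum_range_succ,
      dif_pos hk', finrank_coordFilt_step U k hk', add_assoc]

/-- **Stub `stub_filtrationFinrank`** (line `Sketch` of `FreeSubtorus.OrbitDimensionBound`).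
For a subspace `U` of `Fin n → W` and the filtration `F_i = {v ∈ U : v j = 0 for all j < i}`,
the dimensions of the `i`-th coordinate images `K_i = proj_i (F_i)` add up to `dim U`
(rank–nullity: the kernel of `proj_i` on `F_i` is `F_{i+1}`, and `F_n = 0`; telescoping).
[folklore] -/
theorem stub_filtrationFinrank :
    ∀ {n : ℕ} {W : Type} [AddCommGroup W] [Module ℂ W] [FiniteDimensional ℂ W]
      (U : Submodule ℂ (Fin n → W)),
      Module.finrank ℂ U =
        ∑ i : Fin n, Module.finrank ℂ
          ((U ⊓ ⨅ j ∈ Finset.univ.filter (fun j : Fin n => j < i),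
              LinearMap.ker (LinearMap.proj j : (Fin n → W) →ₗ[ℂ] W)).map
            (LinearMap.proj i : (Fin n → W) →ₗ[ℂ] W)) := by
  intro n W _ _ _ U
  rw [finrank_eq_sum_range_add_finrank_coordFilt U n le_rfl, coordFilt_eq_bot U le_rfl,
    finrank_bot, add_zero, ← Fin.sum_univ_eq_sum_range]
  refine Finset.sum_congr rfl fun i _ => ?_
  rw [dif_pos i.isLt]
  have hF : (U ⊓ ⨅ (j : Fin n) (_ : (j : ℕ) < (i : ℕ)),
        LinearMap.ker (LinearMap.proj j : (Fin n → W) →ₗ[ℂ] W)) =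
      U ⊓ ⨅ j ∈ Finset.univ.filter (fun j : Fin n => j < i),
        LinearMap.ker (LinearMap.proj j : (Fin n → W) →ₗ[ℂ] W) := by
    ext v
    simp only [Submodule.mem_inf, Submodule.mem_iInf, Finset.mem_filter, Finset.mem_univ,
      true_and]
    exact Iff.rfl
  rw [hF]

end Summit.ValiantsHypothesis.ValiantsHypothesis.Theorems.FreeSubtorusOrbitDimensionBound
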